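import Summits.ResolutionOfSingularities.ResolutionOfSingularities.Theorems.HomologicalConductorNoZenoSplitChartAssembly
import HarnessLib

/-!
# D2′ PART 4e′: the upstairs binders of `Sig.L1Core` KEYED TO A GIVEN CHART PRIME (∀-form of p552627)

W4.4 (crux `NoZenoR`, stmt-ResolutionOfSingularities-19943), slot 5 `stub_L1wCoreF3`, closer glue (res-L0-w44-lead-1 g9).
`exists_upstairs_binders` (res-D-pv-039, p552627) hides the chart prime `𝔮f` it chooses behind an `∃` and does not export the
local-étale germ `D' → D'_f` (`chartGerm_bundle`); the ROUTE-M closer needs BOTH keyed to ONE prime (seam-1/seam-2 upstairs on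
`D'_f`, seam-3 descending along `D' → D'_f`).  `exists_upstairs_binders_over` is p552627's statement and proof with the prime `𝔮f`
(and `hover`) as INPUTS and the tie `locPrime (nrm B_f) 𝔮' = locPrime (k[nrm B ∪ {β}]) 𝔮f` as an extra OUTPUT.  OURS (cell
res-hironaka, chain W4.4); AI-written, weaker than expert review; nothing here is a statement of the manuscript under review
(Hironaka 2017).
-/

noncomputable section

set_option linter.dupNamespace false

open IsLocalRing Polynomial
open Summit.ResolutionOfSingularities.ResolutionOfSingularities.Theorems.NoZeno.SandwichCluster
open Parasite (locPrime isLocalRing_locPrime mem_locPrime_of_mem)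
open Thread (toSubring_le_locPrime)
open Summit.ResolutionOfSingularities.ResolutionOfSingularities.Theorems.NoZeno.Birth (nrm nrm_eq_nrm)
open Summit.ResolutionOfSingularities.ResolutionOfSingularities.Theorems.SyzygyFlattening
  (self_le_nrm isIntegrallyClosed_nrm stub_essFiniteType_nrm)

namespace Summit.ResolutionOfSingularities.ResolutionOfSingularities.Theorems.NoZeno.SplittingBase

variable {k K : Type} [Field k] [Field K] [Algebra k K]

open Literature.AlgebraicGeometry.Resolution in
/-- **D2′ — the upstairs binders of `Sig.L1Core`, KEYED TO A GIVEN CHART PRIME** (∀-form of `exists_upstairs_binders`, p552627):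
the same nine clauses for `D'_f := locPrime (nrm B_f) 𝔮'`, for the prime `𝔮'` of `nrm B_f` TRANSPORTED from a GIVEN prime `𝔮f` of
`k[nrm B ∪ {β}]` over `𝔮` (`exists_chartPrime_over`), together with the tie `locPrime (nrm B_f) 𝔮' = locPrime (k[nrm B ∪ {β}]) 𝔮f`
as subrings — so that every other datum keyed to `𝔮f` (`chartGerm_bundle`: the local-étale germ `D' → D'_f`; seam-3) refers to THE
SAME upstairs germ the closer feeds to seam-1/seam-2 (res-L0-w44-lead-1 SHAPE RULE 21:31:14Z).
[this work; the rationality clause is conditional on the named fact `Lipman1969_16_5`] -/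
theorem exists_upstairs_binders_over (T : Subalgebra k K) (P : Ideal ↥T) (hP : P.IsPrime)
    [Algebra.EssFiniteType k ↥T] [IsIntegrallyClosed ↥T] [IsFractionRing ↥T K]
    (f : (↥(locPrimeSubalgebra T P hP))[X]) (hf : f.Monic)
    (hirr : Irreducible (f.map (residue ↥(locPrimeSubalgebra T P hP))))
    (hsep : (f.map (residue ↥(locPrimeSubalgebra T P hP))).Separable)
    [Fact (Irreducible (f.map (algebraMap ↥(locPrimeSubalgebra T P hP) K)))]
    (hPf : (splitPrime (locPrimeSubalgebra T P hP) f).IsPrime)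
    (C : Set K) (hCT : C ⊆ (T : Set K))
    (hrad : (Ideal.span {d : ↥(locPrime T P hP) | (d : K) ∈ C}).radical =
      @maximalIdeal ↥(locPrime T P hP) _ (isLocalRing_locPrime T P hP))
    (x : K) (hxC : x ∈ C) (hx0 : x ≠ 0) (B : Subalgebra k K)
    (hB : B = Algebra.adjoin k ((locPrime T P hP : Set K) ∪ {y : K | ∃ c ∈ C, y = c * x⁻¹}))
    (𝔮 : Ideal ↥(nrm B)) (h𝔮 : 𝔮.IsPrime) (D' : Subring K) (hD' : IsLocalRing ↥D')
    (hEq : locPrime (nrm B) 𝔮 h𝔮 = D') (hdim' : ringKrullDim ↥D' = 2) (hnorm' : IsIntegrallyClosed ↥D')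
    (𝔮f : Ideal ↥(adjoinBeta (nrm B) (f.map (algebraMap ↥(locPrimeSubalgebra T P hP) K)))) (h𝔮f : 𝔮f.IsPrime)
    (hover : ∀ r : ↥(nrm B), toAdjoinBeta (nrm B) (f.map (algebraMap ↥(locPrimeSubalgebra T P hP) K)) r ∈ 𝔮f ↔ r ∈ 𝔮) :
    ∃ (𝔮' : Ideal ↥(nrm (Algebra.adjoin k
        ((locPrime (splitModel (locPrimeSubalgebra T P hP) f) (splitPrime (locPrimeSubalgebra T P hP) f) hPf :
            Set (AdjoinRoot (f.map (algebraMap ↥(locPrimeSubalgebra T P hP) K)))) ∪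
          {y | ∃ c ∈ algebraMap K (AdjoinRoot (f.map (algebraMap ↥(locPrimeSubalgebra T P hP) K))) '' C,
            y = c * (algebraMap K (AdjoinRoot (f.map (algebraMap ↥(locPrimeSubalgebra T P hP) K))) x)⁻¹}))))
      (h𝔮' : 𝔮'.IsPrime),
      -- the tie with the given chart prime `𝔮f`
      (∀ y : AdjoinRoot (f.map (algebraMap ↥(locPrimeSubalgebra T P hP) K)),
        y ∈ locPrime _ 𝔮' h𝔮' ↔
          y ∈ locPrime (adjoinBeta (nrm B) (f.map (algebraMap ↥(locPrimeSubalgebra T P hP) K))) 𝔮f h𝔮f) ∧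
      -- upstairs `C ⊆ T`, `√ = 𝔪`, `x ∈ C`, `x ≠ 0`
      algebraMap K (AdjoinRoot (f.map (algebraMap ↥(locPrimeSubalgebra T P hP) K))) '' C ⊆
        (splitModel (locPrimeSubalgebra T P hP) f : Set _) ∧
      (Ideal.span {d : ↥(locPrime (splitModel (locPrimeSubalgebra T P hP) f)
          (splitPrime (locPrimeSubalgebra T P hP) f) hPf) |
          (d : AdjoinRoot (f.map (algebraMap ↥(locPrimeSubalgebra T P hP) K))) ∈
            algebraMap K (AdjoinRoot (f.map (algebraMap ↥(locPrimeSubalgebra T P hP) K))) '' C}).radical =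
        @maximalIdeal _ _ (isLocalRing_locPrime _ _ hPf) ∧
      algebraMap K (AdjoinRoot (f.map (algebraMap ↥(locPrimeSubalgebra T P hP) K))) x ∈
        algebraMap K (AdjoinRoot (f.map (algebraMap ↥(locPrimeSubalgebra T P hP) K))) '' C ∧
      algebraMap K (AdjoinRoot (f.map (algebraMap ↥(locPrimeSubalgebra T P hP) K))) x ≠ 0 ∧
      -- upstairs `D ⊆ D'`, `dim D' = 2`, `D'` normal, for `D'_f := locPrime (nrm B_f) 𝔮'`
      (locPrime (splitModel (locPrimeSubalgebra T P hP) f) (splitPrime (locPrimeSubalgebra T P hP) f) hPf :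
          Set (AdjoinRoot (f.map (algebraMap ↥(locPrimeSubalgebra T P hP) K)))) ⊆
        (locPrime _ 𝔮' h𝔮' : Set (AdjoinRoot (f.map (algebraMap ↥(locPrimeSubalgebra T P hP) K)))) ∧
      ringKrullDim ↥(locPrime _ 𝔮' h𝔮') = 2 ∧ IsIntegrallyClosed ↥(locPrime _ 𝔮' h𝔮') ∧
      -- descent
      (IsRegularLocalRing ↥(locPrime _ 𝔮' h𝔮') ↔ IsRegularLocalRing ↥D') ∧
      (Lipman1969_16_5.{0} → HasRationalSingularity ↥D' → HasRationalSingularity ↥(locPrime _ 𝔮' h𝔮')) := by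
  subst hEq
  -- the chart ring `B ⊇ T_P`, its normalisation `R := nrm B` (Noetherian, normal, `Frac = K`)
  have hDB : locPrimeSubalgebra T P hP ≤ B := fun y hy => by
    rw [hB]; exact Algebra.subset_adjoin (Or.inl hy)
  haveI : IsFractionRing ↥B K :=
    Literature.AlgebraicGeometry.Resolution.isFractionRing_subalgebra_of_le _ B hDB
  haveI : Algebra.EssFiniteType k ↥B := Thread.essFiniteType_blowupChart T P hP C hCT x B hB
  haveI : Algebra.EssFiniteType k ↥(nrm B) := stub_essFiniteType_nrm k K B inferInstance inferInstance
  haveI : IsNoetherianRing ↥(nrm B) := Algebra.EssFiniteType.isNoetherianRing k _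
  haveI : IsIntegrallyClosed ↥(nrm B) := isIntegrallyClosed_nrm B
  haveI : IsFractionRing ↥(nrm B) K :=
    Literature.AlgebraicGeometry.Resolution.isFractionRing_subalgebra_of_le B _ (self_le_nrm B)
  have hDR : locPrimeSubalgebra T P hP ≤ nrm B := hDB.trans (self_le_nrm B)
  haveI : IsNoetherianRing ↥T := Algebra.EssFiniteType.isNoetherianRing k ↥T
  have hu : IsUnit (AdjoinRoot.mk f (derivative f)) := isUnit_mk_derivative_of_separable_map hf hsep
  -- the chart germ package of PART 4d, for some prime `𝔮f` of `k[nrm B ∪ {β}]` over `𝔮`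
  have hsub := splitGerm_subset_chartGerm (locPrimeSubalgebra T P hP) (nrm B) hDR f 𝔮f h𝔮f hf hirr hPf
  have hIC := isIntegrallyClosed_chartGerm (locPrimeSubalgebra T P hP) (nrm B) hDR f 𝔮f h𝔮f hf hu
  letI := fibreGermAlgebra _ _ _ (chartPoly_map (locPrimeSubalgebra T P hP) (nrm B) hDR f 𝔮 h𝔮) _
    (chartGerm_le (locPrimeSubalgebra T P hP) (nrm B) hDR f 𝔮 h𝔮 𝔮f h𝔮f hover)
  obtain ⟨-, -, -, -, -, -, -, -, hdim, hreg⟩ :=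
    chartGerm_bundle (locPrimeSubalgebra T P hP) (nrm B) hDR f 𝔮 h𝔮 𝔮f h𝔮f hover hf hu
  -- `nrm B_f = k[nrm B ∪ {β}]` (PART 4c), and the transport of `𝔮f` to a prime of `nrm B_f`
  have hNrm := (congrArg nrm (adjoin_chart_eq T P hP f hf hirr hPf C x B hB)).trans
    (nrm_chart_eq T P hP f hf hsep B hDB)
  have hL := locPrime_comap_equivOfEq _ _ hNrm 𝔮f h𝔮f
  refine ⟨𝔮f.comap (Subalgebra.equivOfEq _ _ hNrm : _ →+* _), Ideal.comap_isPrime _ _, fun y => by rw [hL],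
    ?_, radical_span_image_eq T P hP f hf hirr hPf C (fun c hc => toSubring_le_locPrime T P hP (hCT hc)) hrad,
    ⟨x, hxC, rfl⟩, (_root_.map_ne_zero _).mpr hx0, ?_, ?_, ?_, ?_, ?_⟩
  · rintro _ ⟨c, hc, rfl⟩
    exact algebraMap_mem_splitModel _ f (le_locPrimeSubalgebra T P hP (hCT hc))
  · rw [hL]; exact hsub
  · rw [hL]; exact hdim.trans hdim'
  · rw [hL]; exact hIC
  · rw [hL]; exact hreg
  · intro h16_5 hrat
    rw [hL]
    exact hasRationalSingularity_chartGerm (locPrimeSubalgebra T P hP) (nrm B) hDR f 𝔮 h𝔮 𝔮f h𝔮f hover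
      h16_5 hf hu hdim' hrat

end Summit.ResolutionOfSingularities.ResolutionOfSingularities.Theorems.NoZeno.SplittingBase

end
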